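import Summits.QuantumFields.YangMills.Theorems.UnitScaleTiltProp8ChartHInvLetter
import HarnessLib

/-!
# Route `UnitScaleTilt`, crux K1 «MinimiserStabilityRegPr» (stmt-QuantumFields-19200), leaf V2′ `stub_halvingStep` — the P2→P3 BRIDGE in COLUMN form,
# part 1 (geometry): **THE TRANSPOSED VOLUME SUMS OF THE LEVEL WEIGHTS AND THE CORRECTED DATA `X̃′` IN `ℓ¹`** (supplier row (X2-H) of the dressing
# letter `C_E`, ★★OWNER g26 WANTED №g26-1 ∕ ACK 12 (b); weight of record `u(j,c) = η⁻³(Lʲη)⁻¹`, `v(b) = (L^{j(b)}η)⁻³`)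

Cell `ym3-torus` (HUMAN RULING D-0037, YM ladder rung R3 — continuum SU(2) YM₃ on the torus is a RUNG, not the Clay problem), width seat `ym-ust-19200-w8`
gen 0.  `--supports stmt-QuantumFields-19200 --as helper`; def-free, 0 sorry, standard axioms.

WHY.  The dressing letter `C_E` of [Balaban1985Variational] Prop. 4 ((85)–(90) pp. 290–292) for the EXPLICIT dressing current `E = E₁ + E₂ + E₃` of
`HalvingDressedCriticality.fderiv_dressed_eq_pairing` is bounded through TRANSPOSES — `E₃ = −T_Yᵀ[W₀(ΨY)]`, `T_Y = H∘D′(Y)` — and a transpose is bounded on the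
`(L^{j(b)}η)³`-weighted currents iff the operator itself is bounded on `ℓ¹` of the DUAL weight `v(b) = (L^{j(b)}η)⁻³` (seat `ym-ust-19936-w8`'s LOCATE: the two
column letters (X2-H) for `H`, (X2-C′) for `C′`, displayed in `…Prop8DressingTransposeLetters`).  This file and its sequel `…ChartHInvColumnLetter` prove (X2-H)
for the chart-H OF RECORD `H X = H₀ᴹX̃′ + dφ` of `ChartHInvBridge`∕`ChartHInvLetter`.  HERE: the GEOMETRY — fibre counts of the block maps, the transposed
volume sums of the inverse weights over the block of a site index (with the territory collar of (2.2) for the final points), and the `ℓ¹` bookkeeping of the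
corrected data `X̃′(j,c) = (Lʲη)⁻¹(X(j,c) + κ_j(c₊) − κ_j(c₋))` against the index bonds of the blocks (a level-`i` index bond inside `B(y)` is seen by at most
`d` straddling index bonds of level `i+1` at either end-point, whose scale factor `(L^{i+1}η)⁻¹` is below `(Lⁱη)⁻¹`).

WHAT IS PROVED (sorry-free; no definition), for every `P : Params`, nested family `D`, scale `η > 0`, matrix size `n`:
* §1 `card_fiber_site_iterBlockOf_le`, `card_fiber_tgt_iterBlockOf_le` (`≤ (Lʲ)^d`, `≤ (Lʲ)^d·d`); **`sum_fiber_src_inv_w₃_le`** — at `d = 3`,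
  `Σ_{b₋ ∈ B(s)} (L^{j(b)}η)⁻³ ≤ 3η⁻³` for every site index `s` (all of territory `j(s)`; LEVEL-FREE); **`sum_fiber_tgt_inv_w₃_le`** — `Σ_{b₊ ∈ B(s)} (L^{j(b)}η)⁻³
  ≤ 3L³η⁻³` under `Adm22 D R M`, `R·M ≥ 1` (collar `j(b₊) ≤ j(b₋) + 1`, `ChartHInvTent.levOf_endpoints_le_succ`).
* §2 `card_idx_tgt_le`, `card_idx_src_le` (`≤ d` index bonds of a level with a given end-point); **`norm_kappa_le_sum`** (`‖κ_j(y)‖ ≤ (d+2)L·Σ_{(i,c) ∈ 𝔅,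
  i+1 = j, c ⊂ B(y)}‖X(i,c)‖`, the `ℓ¹` form of `ChartHInvLetter.norm_kappa_le`); **`sum_norm_Xt_le`** (`Σ_{(j,c)}‖X̃′(j,c)‖ ≤ (1 + 2d(d+2)L)·Σ_{(j,c)} (Lʲη)⁻¹‖X(j,c)‖`).
HONEST SCOPE.  Finite sums and counting over the objects of the construction; `H₀`, the tents and every estimate of Bałaban's are NOT involved here (part 2 takes
`H₀`'s block kernel majorant as a DISPLAYED hypothesis); nothing of (72)∕(73) (`D′`, the other column letter (X2-C′)) is claimed; NOT a claim about the stub, the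
crux, the rung or the mass gap.

References: T. Bałaban, CMP **102** (1985) 277–309 [Balaban1985Variational] (46) p.285, (88)–(90) pp.291–292, (156)–(157) p.302, (161)–(162) p.303; CMP **98**
(1985) 17–51 [Balaban1985Averaging] (62) p.28; CMP **96** (1984) 223–250 [Balaban1984PropagatorsII] (2.1)–(2.4) p.224, (2.61) p.234, Cor. 2.8 (2.150)–(2.151)
p.249; CMP **95** (1984) 17–40 [Balaban1984PropagatorsI] (1.18) p.20.
-/

set_option autoImplicit false

noncomputable section

open scoped BigOperators Matrix.Norms.L2Operator

namespace Summit.QuantumFields.YangMills.Theorems.ChartHInv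

open Literature.MathematicalPhysics.QuantumFieldTheory.Balaban1983to89
open T4Continuum BlockAveraging BlockAveragingEMLLinearised LatticeFieldCalculus
open B5Eq118OneStroke (iterBlockOf iterBlockOf_zero iterBlockOf_succ)
open B15DeterminingSets (embIter)
open B6SectADomainsV1 (Domains)
open B6SectAOperatorsV1 (BondIdx SiteIdx)
open B11Eq115Space (levOf)
open Summit.QuantumFields.YangMills.Theorems.FlatCubeOpsText (Adm22)
open Literature.MathematicalPhysics.QuantumFieldTheory.BalabanImbrieJaffe1984to88.BIJ88RT51Background (iterBlockOf_embIter)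
open Literature.MathematicalPhysics.QuantumFieldTheory.Balaban1983to89.B6BlockDecayHjCovV1 (blockOf_EK_eq_iterBlockOf card_fiber_src_iterBlockOf_le)

variable {P : Params} {n : Type*}

/-! ## §1 Fibres of the block maps and the transposed volume sums -/

section Fibres

/-- At most `(L^j)^d` fine sites lie over a site of `T^{(j)}` under the `j`-fold block map. [cite: Balaban1984PropagatorsI, (1.18) p.20] -/
theorem card_fiber_site_iterBlockOf_le {j : ℕ} (hj : j ≤ P.m + P.K) (y : Site P j) :
    (Finset.univ.filter fun x : Site P 0 => iterBlockOf j x = y).card ≤ (P.L ^ j) ^ P.d := by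
  classical
  have h := B6HprimeOpNormV1.card_filter_blockOf_EK_le hj y
  refine le_trans (Finset.card_le_card fun x hx => ?_) h
  rw [Finset.mem_filter] at hx ⊢
  exact ⟨hx.1, by rw [blockOf_EK_eq_iterBlockOf hj]; exact hx.2⟩

/-- At most `(L^j)^d·d` fine bonds have their FINAL point over a given site of `T^{(j)}` (a bond is determined by its final point and its direction).
[cite: Balaban1984PropagatorsI, (1.18) p.20] -/
theorem card_fiber_tgt_iterBlockOf_le {j : ℕ} (hj : j ≤ P.m + P.K) (y : Site P j) :
    (Finset.univ.filter fun b : PBond P 0 => iterBlockOf j b.tgt = y).card ≤ (P.L ^ j) ^ P.d * P.d := by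
  classical
  have hinj : Set.InjOn (fun b : PBond P 0 => (b.tgt, b.dir)) ↑(Finset.univ.filter fun b : PBond P 0 => iterBlockOf j b.tgt = y) := by
    intro b₁ _ b₂ _ h
    simp only [Prod.mk.injEq] at h
    obtain ⟨ht, hdir⟩ := h
    have hs : b₁.src = b₂.src := by
      have h1 : b₁.src = b₁.tgt.unshift b₁.dir := (B10StarCount.unshift_shift b₁.src b₁.dir).symm
      have h2 : b₂.src = b₂.tgt.unshift b₂.dir := (B10StarCount.unshift_shift b₂.src b₂.dir).symm
      rw [h1, h2, ht, hdir]
    cases b₁; cases b₂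
    simp only at hs hdir
    rw [hs, hdir]
  have hmaps : Set.MapsTo (fun b : PBond P 0 => (b.tgt, b.dir)) ↑(Finset.univ.filter fun b : PBond P 0 => iterBlockOf j b.tgt = y)
      ↑((Finset.univ.filter fun x : Site P 0 => iterBlockOf j x = y) ×ˢ (Finset.univ : Finset (Fin P.d))) := by
    intro b hb
    simp only [Finset.coe_filter, Set.mem_setOf_eq, Finset.mem_univ, true_and] at hb
    simp [hb]
  calc (Finset.univ.filter fun b : PBond P 0 => iterBlockOf j b.tgt = y).card
      ≤ ((Finset.univ.filter fun x : Site P 0 => iterBlockOf j x = y) ×ˢ (Finset.univ : Finset (Fin P.d))).card :=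
        Finset.card_le_card_of_injOn _ hmaps hinj
    _ ≤ (P.L ^ j) ^ P.d * P.d := by
        rw [Finset.card_product, Finset.card_univ, Fintype.card_fin]
        exact Nat.mul_le_mul_right _ (card_fiber_site_iterBlockOf_le hj y)

variable (D : Domains P) (η : ℝ) (w₃ : PBond P 0 → ℝ)
  (hw₃ : ∀ b, w₃ b = ((P.L : ℝ) ^ levOf (fun i => {z : Site P 0 | D.InOm i z}) D.k b.src * η) ^ 3)

include hw₃ in
/-- **THE TRANSPOSED VOLUME SUM AT A SITE INDEX (initial points)**: at `d = 3`, over the fine bonds whose initial point lies in the block `B^j(y)` of a site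
index `(j, y) ∈ 𝔅′` — all of territory `j`, so of weight `w₃ = (L^jη)³` — the inverse weights sum to at most `3·η⁻³` (`≤ 3·L^{3j}` bonds); LEVEL-FREE.
[cite: Balaban1984PropagatorsII, (2.4) p.224; Balaban1985Variational, (161)-(162) p.303] -/
theorem sum_fiber_src_inv_w₃_le (hd : P.d = 3) (hη : 0 < η) (s : SiteIdx D) :
    ∑ b ∈ Finset.univ.filter (fun b : PBond P 0 => iterBlockOf (s.1.1 : ℕ) b.src = s.1.2), (w₃ b)⁻¹ ≤ 3 * (η⁻¹) ^ 3 := by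
  classical
  have hj : (s.1.1 : ℕ) ≤ P.m + P.K := (D.le_of_lamSite s.2).trans D.hk
  have hL0 : (0 : ℝ) < P.L := by exact_mod_cast P.L_pos
  have hLj : (0 : ℝ) < (P.L : ℝ) ^ (s.1.1 : ℕ) := pow_pos hL0 _
  set c : ℝ := (((P.L : ℝ) ^ (s.1.1 : ℕ) * η) ^ 3)⁻¹ with hc
  have hconst : ∀ b ∈ Finset.univ.filter (fun b : PBond P 0 => iterBlockOf (s.1.1 : ℕ) b.src = s.1.2), (w₃ b)⁻¹ = c := by
    intro b hb
    rw [Finset.mem_filter] at hb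
    have hlev : levOf (fun i => {z : Site P 0 | D.InOm i z}) D.k b.src = (s.1.1 : ℕ) :=
      FlatCubeLevels.levOf_inOm_unique D (by rw [hb.2]; exact s.2)
    rw [hw₃, hlev]
  rw [Finset.sum_congr rfl hconst, Finset.sum_const, nsmul_eq_mul]
  have hcard := card_fiber_src_iterBlockOf_le hj s.1.2
  rw [hd] at hcard
  have hc0 : 0 ≤ c := by rw [hc]; positivity
  calc ((Finset.univ.filter (fun b : PBond P 0 => iterBlockOf (s.1.1 : ℕ) b.src = s.1.2)).card : ℝ) * c
      ≤ (((P.L ^ (s.1.1 : ℕ)) ^ 3 * 3 : ℕ) : ℝ) * c := mul_le_mul_of_nonneg_right (by exact_mod_cast hcard) hc0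
    _ = 3 * (η⁻¹) ^ 3 := by
        rw [hc]; push_cast
        field_simp

include hw₃ in
/-- **THE TRANSPOSED VOLUME SUM AT A SITE INDEX (final points)**: under (2.2)-admissibility with `R·M ≥ 1` the territory of the initial point of a fine bond is
at least the territory of its final point minus one (collar), so over the fine bonds whose FINAL point lies in `B^j(y)`, `(j, y) ∈ 𝔅′`, the inverse weights
sum to at most `3·L³·η⁻³` at `d = 3`. [cite: Balaban1984PropagatorsII, (2.2)-(2.4) p.224; Balaban1985Variational, (161)-(162) p.303] -/
theorem sum_fiber_tgt_inv_w₃_le (hd : P.d = 3) (hη : 0 < η) {R M : ℕ} (hAdm : Adm22 D R M) (hRM : 1 ≤ R * M) (s : SiteIdx D) :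
    ∑ b ∈ Finset.univ.filter (fun b : PBond P 0 => iterBlockOf (s.1.1 : ℕ) b.tgt = s.1.2), (w₃ b)⁻¹ ≤ 3 * (P.L : ℝ) ^ 3 * (η⁻¹) ^ 3 := by
  classical
  have hj : (s.1.1 : ℕ) ≤ P.m + P.K := (D.le_of_lamSite s.2).trans D.hk
  have hL1 : (1 : ℝ) ≤ P.L := by exact_mod_cast P.L_pos
  have hL0 : (0 : ℝ) < P.L := by positivity
  set c : ℝ := (P.L : ℝ) ^ 3 * (((P.L : ℝ) ^ (s.1.1 : ℕ) * η) ^ 3)⁻¹ with hc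
  have hc0 : 0 ≤ c := by rw [hc]; positivity
  have hle : ∀ b ∈ Finset.univ.filter (fun b : PBond P 0 => iterBlockOf (s.1.1 : ℕ) b.tgt = s.1.2), (w₃ b)⁻¹ ≤ c := by
    intro b hb
    rw [Finset.mem_filter] at hb
    have hlev : levOf (fun i => {z : Site P 0 | D.InOm i z}) D.k b.tgt = (s.1.1 : ℕ) :=
      FlatCubeLevels.levOf_inOm_unique D (by rw [hb.2]; exact s.2)
    have hcol := (levOf_endpoints_le_succ D hAdm hRM b).2
    rw [hlev] at hcol
    -- `L^j ≤ L^{j₁}·L`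
    set j₁ := levOf (fun i => {z : Site P 0 | D.InOm i z}) D.k b.src with hj₁
    have hpow : (P.L : ℝ) ^ (s.1.1 : ℕ) ≤ (P.L : ℝ) ^ j₁ * P.L := by
      rw [← pow_succ]; exact pow_le_pow_right₀ hL1 hcol
    have hw0 : 0 < w₃ b := by rw [hw₃]; positivity
    rw [hw₃, hc]
    rw [← hj₁]
    -- (L^{j₁}η)^{-3} ≤ L³ (L^jη)^{-3}
    have hpos : 0 < ((P.L : ℝ) ^ (s.1.1 : ℕ) * η) ^ 3 := by positivity
    rw [← div_eq_mul_inv, le_div_iff₀ hpos]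
    have hbase : (P.L : ℝ) ^ (s.1.1 : ℕ) * η ≤ (P.L : ℝ) ^ j₁ * η * P.L := by nlinarith [hη.le]
    have hb0 : 0 ≤ (P.L : ℝ) ^ (s.1.1 : ℕ) * η := by positivity
    calc (((P.L : ℝ) ^ j₁ * η) ^ 3)⁻¹ * ((P.L : ℝ) ^ (s.1.1 : ℕ) * η) ^ 3
        ≤ (((P.L : ℝ) ^ j₁ * η) ^ 3)⁻¹ * ((P.L : ℝ) ^ j₁ * η * P.L) ^ 3 :=
          mul_le_mul_of_nonneg_left (pow_le_pow_left₀ hb0 hbase 3) (by positivity)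
      _ = (P.L : ℝ) ^ 3 := by
          have hne : ((P.L : ℝ) ^ j₁ * η) ^ 3 ≠ 0 := by positivity
          field_simp
  have hcard := card_fiber_tgt_iterBlockOf_le hj s.1.2
  rw [hd] at hcard
  calc ∑ b ∈ Finset.univ.filter (fun b : PBond P 0 => iterBlockOf (s.1.1 : ℕ) b.tgt = s.1.2), (w₃ b)⁻¹
      ≤ ∑ b ∈ Finset.univ.filter (fun b : PBond P 0 => iterBlockOf (s.1.1 : ℕ) b.tgt = s.1.2), c := Finset.sum_le_sum hle
    _ = ((Finset.univ.filter (fun b : PBond P 0 => iterBlockOf (s.1.1 : ℕ) b.tgt = s.1.2)).card : ℝ) * c := by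
        rw [Finset.sum_const, nsmul_eq_mul]
    _ ≤ (((P.L ^ (s.1.1 : ℕ)) ^ 3 * 3 : ℕ) : ℝ) * c := mul_le_mul_of_nonneg_right (by exact_mod_cast hcard) hc0
    _ = 3 * (P.L : ℝ) ^ 3 * (η⁻¹) ^ 3 := by
        rw [hc]; push_cast
        field_simp

end Fibres

/-! ## §2 The corrected data `X̃′` in the `ℓ¹` currency: the end-point correction `κ` against the index bonds of the block -/

section IdxFibres

variable (D : Domains P)

/-- At most `d` index bonds of a given level have a given FINAL point (their direction determines them). [cite: Balaban1984PropagatorsII, (2.3) p.224] -/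
theorem card_idx_tgt_le (m : ℕ) (x₀ : Site P 0) :
    (Finset.univ.filter fun i : BondIdx D => m = (i.1.1 : ℕ) ∧ iterBlockOf (i.1.1 : ℕ) x₀ = i.1.2.tgt).card ≤ P.d := by
  classical
  have hinj : Set.InjOn (fun i : BondIdx D => i.1.2.dir)
      ↑(Finset.univ.filter fun i : BondIdx D => m = (i.1.1 : ℕ) ∧ iterBlockOf (i.1.1 : ℕ) x₀ = i.1.2.tgt) := by
    rintro ⟨⟨l₁, c₁⟩, h₁⟩ hi₁ ⟨⟨l₂, c₂⟩, h₂⟩ hi₂ hdir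
    simp only [Finset.coe_filter, Finset.mem_univ, true_and, Set.mem_setOf_eq] at hi₁ hi₂ hdir
    obtain ⟨hl₁, ht₁⟩ := hi₁
    obtain ⟨hl₂, ht₂⟩ := hi₂
    have hl : l₁ = l₂ := Fin.ext (hl₁.symm.trans hl₂)
    subst hl
    have hc : c₁ = c₂ := by
      have hs : c₁.src = c₂.src := by
        rw [← B10StarCount.unshift_shift c₁.src c₁.dir, ← B10StarCount.unshift_shift c₂.src c₂.dir]
        show c₁.tgt.unshift c₁.dir = c₂.tgt.unshift c₂.dir
        rw [← ht₁, ← ht₂, hdir]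
      cases c₁; cases c₂; simp only at hs hdir; rw [hs, hdir]
    subst hc
    rfl
  calc (Finset.univ.filter fun i : BondIdx D => m = (i.1.1 : ℕ) ∧ iterBlockOf (i.1.1 : ℕ) x₀ = i.1.2.tgt).card
      ≤ (Finset.univ : Finset (Fin P.d)).card :=
        Finset.card_le_card_of_injOn _ (fun _ _ => Finset.mem_coe.2 (Finset.mem_univ _)) hinj
    _ = P.d := by rw [Finset.card_univ, Fintype.card_fin]

/-- At most `d` index bonds of a given level have a given INITIAL point. [cite: Balaban1984PropagatorsII, (2.3) p.224] -/
theorem card_idx_src_le (m : ℕ) (x₀ : Site P 0) :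
    (Finset.univ.filter fun i : BondIdx D => m = (i.1.1 : ℕ) ∧ iterBlockOf (i.1.1 : ℕ) x₀ = i.1.2.src).card ≤ P.d := by
  classical
  have hinj : Set.InjOn (fun i : BondIdx D => i.1.2.dir)
      ↑(Finset.univ.filter fun i : BondIdx D => m = (i.1.1 : ℕ) ∧ iterBlockOf (i.1.1 : ℕ) x₀ = i.1.2.src) := by
    rintro ⟨⟨l₁, c₁⟩, h₁⟩ hi₁ ⟨⟨l₂, c₂⟩, h₂⟩ hi₂ hdir
    simp only [Finset.coe_filter, Finset.mem_univ, true_and, Set.mem_setOf_eq] at hi₁ hi₂ hdir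
    obtain ⟨hl₁, hs₁⟩ := hi₁
    obtain ⟨hl₂, hs₂⟩ := hi₂
    have hl : l₁ = l₂ := Fin.ext (hl₁.symm.trans hl₂)
    subst hl
    have hc : c₁ = c₂ := by
      have hs : c₁.src = c₂.src := by rw [← hs₁, ← hs₂]
      cases c₁; cases c₂; simp only at hs hdir; rw [hs, hdir]
    subst hc
    rfl
  calc (Finset.univ.filter fun i : BondIdx D => m = (i.1.1 : ℕ) ∧ iterBlockOf (i.1.1 : ℕ) x₀ = i.1.2.src).card
      ≤ (Finset.univ : Finset (Fin P.d)).card :=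
        Finset.card_le_card_of_injOn _ (fun _ _ => Finset.mem_coe.2 (Finset.mem_univ _)) hinj
    _ = P.d := by rw [Finset.card_univ, Fintype.card_fin]

end IdxFibres

section Construction

variable (D : Domains P) (η : ℝ)
  -- the data as level fields, the end-point correction, the corrected data
  (Xf : (BondIdx D → Matrix n n ℂ) → (i : ℕ) → PBond P i → Matrix n n ℂ)
  (hXf : ∀ X i b, Xf X i b = if h : D.LamBond i b then X ⟨⟨⟨i, Nat.lt_succ_of_le (D.le_of_lamBond h)⟩, b⟩, h⟩ else 0)
  (κ : (BondIdx D → Matrix n n ℂ) → (j : ℕ) → Site P j → Matrix n n ℂ)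
  (hκ0 : ∀ X y, κ X 0 y = 0)
  (hκs : ∀ X (i : ℕ) (y : Site P (i + 1)), κ X (i + 1) y = if y ∈ D.Om (i + 1) then 0 else combMean (Xf X i) y)
  (Xt : (BondIdx D → Matrix n n ℂ) → BondIdx D → Matrix n n ℂ)
  (hXt : ∀ X idx, Xt X idx = (((P.L : ℝ) ^ (idx.1.1 : ℕ) * η)⁻¹) • (X idx + (κ X idx.1.1 idx.1.2.tgt - κ X idx.1.1 idx.1.2.src)))

section Ell1

variable [Fintype n] [DecidableEq n]

include hXf hκ0 hκs in
/-- **THE END-POINT CORRECTION AGAINST THE INDEX BONDS OF THE BLOCK** (the comb mean `λ̄_{X_i}(y)` is a staircase sum of at most `(d+2)L` data, each an index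
bond of level `i` inside `B(y)`): `‖κ_j(y)‖ ≤ (d+2)L·Σ_{(i,c) ∈ 𝔅, i+1 = j, c ⊂ B(y)} ‖X(i,c)‖` — the `ℓ¹` form of `norm_kappa_le`.
[cite: Balaban1985Averaging, (62) p.28; Balaban1985Variational, (156) p.302] -/
theorem norm_kappa_le_sum (X : BondIdx D → Matrix n n ℂ) (j : ℕ) (hj : j ≤ P.m + P.K) (y : Site P j) :
    ‖κ X j y‖ ≤ ((P.d + 2) * P.L : ℕ) * ∑ i : BondIdx D,
      (if (i.1.1 : ℕ) + 1 = j ∧ iterBlockOf j (embIter (i.1.1 : ℕ) i.1.2.src) = y then ‖X i‖ else 0) := by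
  classical
  cases j with
  | zero => rw [hκ0, norm_zero]; positivity
  | succ j =>
    rw [hκs]
    have hsum0 : 0 ≤ ∑ i : BondIdx D,
        (if (i.1.1 : ℕ) + 1 = j + 1 ∧ iterBlockOf (j + 1) (embIter (i.1.1 : ℕ) i.1.2.src) = y then ‖X i‖ else 0) :=
      Finset.sum_nonneg fun i _ => by positivity
    split_ifs with hy
    · rw [norm_zero]; positivity
    · refine norm_combMean_le_of_local hj (Xf X j) y hsum0 fun b hbs _ => ?_
      rw [hXf]
      split_ifs with hb
      · set i₀ : BondIdx D := ⟨⟨⟨j, Nat.lt_succ_of_le (D.le_of_lamBond hb)⟩, b⟩, hb⟩ with hi₀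
        have hcond : (i₀.1.1 : ℕ) + 1 = j + 1 ∧ iterBlockOf (j + 1) (embIter (i₀.1.1 : ℕ) i₀.1.2.src) = y := by
          refine ⟨rfl, ?_⟩
          show iterBlockOf (j + 1) (embIter j b.src) = y
          rw [iterBlockOf_succ, iterBlockOf_embIter j (by omega) b.src, hbs]
        have hle := Finset.single_le_sum (f := fun i : BondIdx D =>
            (if (i.1.1 : ℕ) + 1 = j + 1 ∧ iterBlockOf (j + 1) (embIter (i.1.1 : ℕ) i.1.2.src) = y then ‖X i‖ else 0))
          (fun i _ => by positivity) (Finset.mem_univ i₀)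
        simp only [if_pos hcond] at hle
        exact hle
      · rw [norm_zero]; exact hsum0

include hXf hκ0 hκs hXt in
/-- **THE CORRECTED DATA IN `ℓ¹`**: `Σ_{(j,c)} ‖X̃′(j,c)‖ ≤ (1 + 2d(d+2)L)·Σ_{(j,c)} (L^jη)⁻¹‖X(j,c)‖` — every index bond of level `i` inside a block `B(y)` is
seen by at most `d` straddling index bonds with initial (resp. final) point `y`, of level `i+1`, whose scale factor `(L^{i+1}η)⁻¹` is below `(L^iη)⁻¹`.
[cite: Balaban1985Variational, (156)-(157) p.302; Balaban1985Averaging, (62) p.28] -/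
theorem sum_norm_Xt_le (hη : 0 < η) (X : BondIdx D → Matrix n n ℂ) :
    ∑ i : BondIdx D, ‖Xt X i‖ ≤ (1 + 2 * (((P.d + 2) * P.L : ℕ) : ℝ) * P.d) *
      ∑ i : BondIdx D, ((P.L : ℝ) ^ (i.1.1 : ℕ) * η)⁻¹ * ‖X i‖ := by
  classical
  have hL1 : (1 : ℝ) ≤ P.L := by exact_mod_cast P.L_pos
  have hL0 : (0 : ℝ) < P.L := by positivity
  set C : ℝ := (((P.d + 2) * P.L : ℕ) : ℝ) with hC
  have hC0 : 0 ≤ C := by positivity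
  set ρ : BondIdx D → ℝ := fun i => ((P.L : ℝ) ^ (i.1.1 : ℕ) * η)⁻¹ with hρ
  have hρpos : ∀ i, 0 < ρ i := fun i => by positivity
  -- the majorant of `κ`
  set Mj : (j : ℕ) → Site P j → ℝ := fun j y => ∑ i' : BondIdx D,
      (if (i'.1.1 : ℕ) + 1 = j ∧ iterBlockOf j (embIter (i'.1.1 : ℕ) i'.1.2.src) = y then ‖X i'‖ else 0) with hMj
  have hMj0 : ∀ j y, 0 ≤ Mj j y := fun j y => Finset.sum_nonneg fun i _ => by positivity
  have hκb : ∀ (i : BondIdx D) (z : Site P (i.1.1 : ℕ)), ‖κ X (i.1.1 : ℕ) z‖ ≤ C * Mj (i.1.1 : ℕ) z := fun i z =>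
    norm_kappa_le_sum D Xf hXf κ hκ0 hκs X (i.1.1 : ℕ) ((D.le_of_lamBond i.2).trans D.hk) z
  -- pointwise bound on the corrected data
  have hXt_le : ∀ i, ‖Xt X i‖ ≤ ρ i * ‖X i‖ + C * (ρ i * Mj _ i.1.2.tgt) + C * (ρ i * Mj _ i.1.2.src) := by
    intro i
    rw [hXt, norm_smul, Real.norm_eq_abs, abs_of_pos (hρpos i)]
    have h1 := hκb i i.1.2.tgt
    have h2 := hκb i i.1.2.src
    calc ρ i * ‖X i + (κ X _ i.1.2.tgt - κ X _ i.1.2.src)‖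
        ≤ ρ i * (‖X i‖ + (‖κ X _ i.1.2.tgt‖ + ‖κ X _ i.1.2.src‖)) :=
          mul_le_mul_of_nonneg_left ((norm_add_le _ _).trans (add_le_add le_rfl (norm_sub_le _ _))) (hρpos i).le
      _ ≤ ρ i * (‖X i‖ + (C * Mj _ i.1.2.tgt + C * Mj _ i.1.2.src)) :=
          mul_le_mul_of_nonneg_left (add_le_add le_rfl (add_le_add h1 h2)) (hρpos i).le
      _ = ρ i * ‖X i‖ + C * (ρ i * Mj _ i.1.2.tgt) + C * (ρ i * Mj _ i.1.2.src) := by ring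
  -- the inner counting sums
  have hinner : ∀ (i' : BondIdx D) (p : (i : BondIdx D) → Site P (i.1.1 : ℕ)),
      (∀ i, p i = i.1.2.tgt) ∨ (∀ i, p i = i.1.2.src) →
      ∑ i : BondIdx D, (if (i'.1.1 : ℕ) + 1 = (i.1.1 : ℕ) ∧ iterBlockOf (i.1.1 : ℕ) (embIter (i'.1.1 : ℕ) i'.1.2.src) = p i
        then ρ i else 0) ≤ P.d * ρ i' := by
    intro i' p hp
    set x₀ : Site P 0 := embIter (i'.1.1 : ℕ) i'.1.2.src with hx₀
    set m : ℕ := (i'.1.1 : ℕ) + 1 with hm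
    rw [← Finset.sum_filter]
    set S := Finset.univ.filter (fun i : BondIdx D => m = (i.1.1 : ℕ) ∧ iterBlockOf (i.1.1 : ℕ) x₀ = p i) with hS
    -- on `S` the scale factor is the constant `(L^mη)⁻¹ ≤ ρ i'`
    have hconst : ∀ i ∈ S, ρ i = ((P.L : ℝ) ^ m * η)⁻¹ := by
      intro i hi
      rw [hS, Finset.mem_filter] at hi
      show ((P.L : ℝ) ^ (i.1.1 : ℕ) * η)⁻¹ = _
      rw [← hi.2.1]
    have hcard : S.card ≤ P.d := by
      rcases hp with hp | hp
      · have : S = Finset.univ.filter (fun i : BondIdx D => m = (i.1.1 : ℕ) ∧ iterBlockOf (i.1.1 : ℕ) x₀ = i.1.2.tgt) := by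
          rw [hS]; congr 1; ext i; rw [hp i]
        rw [this]; exact card_idx_tgt_le D m x₀
      · have : S = Finset.univ.filter (fun i : BondIdx D => m = (i.1.1 : ℕ) ∧ iterBlockOf (i.1.1 : ℕ) x₀ = i.1.2.src) := by
          rw [hS]; congr 1; ext i; rw [hp i]
        rw [this]; exact card_idx_src_le D m x₀
    have hmono : ((P.L : ℝ) ^ m * η)⁻¹ ≤ ρ i' := by
      show ((P.L : ℝ) ^ m * η)⁻¹ ≤ ((P.L : ℝ) ^ (i'.1.1 : ℕ) * η)⁻¹
      rw [hm]
      refine inv_anti₀ (by positivity) (mul_le_mul_of_nonneg_right ?_ hη.le)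
      exact pow_le_pow_right₀ hL1 (Nat.le_succ _)
    calc ∑ i ∈ S, ρ i = ∑ i ∈ S, ((P.L : ℝ) ^ m * η)⁻¹ := Finset.sum_congr rfl hconst
      _ = (S.card : ℝ) * ((P.L : ℝ) ^ m * η)⁻¹ := by rw [Finset.sum_const, nsmul_eq_mul]
      _ ≤ (P.d : ℝ) * ρ i' := mul_le_mul (by exact_mod_cast hcard) hmono (by positivity) (by positivity)
  -- the two `κ` sums
  have hsum : ∀ (p : (i : BondIdx D) → Site P (i.1.1 : ℕ)), (∀ i, p i = i.1.2.tgt) ∨ (∀ i, p i = i.1.2.src) →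
      ∑ i : BondIdx D, ρ i * Mj _ (p i) ≤ P.d * ∑ i' : BondIdx D, ρ i' * ‖X i'‖ := by
    intro p hp
    calc ∑ i : BondIdx D, ρ i * Mj _ (p i)
        = ∑ i : BondIdx D, ∑ i' : BondIdx D,
            (if (i'.1.1 : ℕ) + 1 = (i.1.1 : ℕ) ∧ iterBlockOf (i.1.1 : ℕ) (embIter (i'.1.1 : ℕ) i'.1.2.src) = p i
              then ρ i else 0) * ‖X i'‖ := by
          refine Finset.sum_congr rfl fun i _ => ?_
          rw [hMj, Finset.mul_sum]
          refine Finset.sum_congr rfl fun i' _ => ?_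
          split_ifs <;> simp
      _ = ∑ i' : BondIdx D, (∑ i : BondIdx D,
            (if (i'.1.1 : ℕ) + 1 = (i.1.1 : ℕ) ∧ iterBlockOf (i.1.1 : ℕ) (embIter (i'.1.1 : ℕ) i'.1.2.src) = p i
              then ρ i else 0)) * ‖X i'‖ := by
          rw [Finset.sum_comm]
          refine Finset.sum_congr rfl fun i' _ => ?_
          rw [Finset.sum_mul]
      _ ≤ ∑ i' : BondIdx D, (P.d * ρ i') * ‖X i'‖ :=
          Finset.sum_le_sum fun i' _ => mul_le_mul_of_nonneg_right (hinner i' p hp) (norm_nonneg _)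
      _ = P.d * ∑ i' : BondIdx D, ρ i' * ‖X i'‖ := by rw [Finset.mul_sum]; refine Finset.sum_congr rfl fun i' _ => ?_; ring
  have hT := hsum (fun i => i.1.2.tgt) (Or.inl fun _ => rfl)
  have hS := hsum (fun i => i.1.2.src) (Or.inr fun _ => rfl)
  calc ∑ i, ‖Xt X i‖ ≤ ∑ i, (ρ i * ‖X i‖ + C * (ρ i * Mj _ i.1.2.tgt) + C * (ρ i * Mj _ i.1.2.src)) :=
        Finset.sum_le_sum fun i _ => hXt_le i
    _ = ∑ i, ρ i * ‖X i‖ + C * ∑ i, ρ i * Mj _ i.1.2.tgt + C * ∑ i, ρ i * Mj _ i.1.2.src := by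
        rw [Finset.sum_add_distrib, Finset.sum_add_distrib, Finset.mul_sum, Finset.mul_sum]
    _ ≤ ∑ i, ρ i * ‖X i‖ + C * (P.d * ∑ i', ρ i' * ‖X i'‖) + C * (P.d * ∑ i', ρ i' * ‖X i'‖) :=
        add_le_add (add_le_add le_rfl (mul_le_mul_of_nonneg_left hT hC0)) (mul_le_mul_of_nonneg_left hS hC0)
    _ = (1 + 2 * C * P.d) * ∑ i, ρ i * ‖X i‖ := by ring

end Ell1

end Construction


end Summit.QuantumFields.YangMills.Theorems.ChartHInv

end
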